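import Mathlib
import Summits.Ventures.PercRepro2.Defs
import Summits.Ventures.PercRepro2.Harris
import Summits.Ventures.PercRepro2.Graph
import Summits.Ventures.PercRepro2.Induced
import Summits.Ventures.PercRepro2.VdBKahn
import Summits.Ventures.PercRepro2.BHK
import Summits.Ventures.PercRepro2.BHKEvents
import Summits.Ventures.PercRepro2.WForm
import Summits.Ventures.PercRepro2.WStatus
import Summits.Ventures.PercRepro2.WAltDefs
import Summits.Ventures.PercRepro2.WAltTheorem
import Summits.Ventures.PercRepro2.WStatusDict
import Summits.Ventures.PercRepro2.WAll

/-!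
# (W-ext): the W-inequality for monotone functionals of the WHOLE cluster
(blind cell PercRepro2, mine-1 g15; proofs/MINE1-W-THEOREM.md §0 (W-ext), MINE1-WBERN.md §2)

`clusterW p ends s T C = P(C(s) = C, C(s) ∩ T = ∅)` is the avoiding cluster law as a weight on
`Set V`, and `FDisjoint F C C' = Disjoint (C ∩ F) (C' ∩ F)`. **`wExt_all`**: for every admissible
weight vector, root, avoided set `T` and disjointness set `F`,
`∑_{C ∩ C' ∩ F = ∅} clusterW C · clusterW C' · (φ C − φ C')(ψ C − ψ C') ≥ 0`
for all monotone `φ, ψ : Set V → R` (`WExt p ends s T F`). The status version `wIneqStatus_all`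
(WAll.lean) is the case `φ = g(· ∩ F)`; here nothing is projected to `F`, so the family contains
the core-forbidden principal family (`φ = 1{x ∈ ·}`, `ψ = 1{y ∈ ·}`, any `F`, any `T`) and, for
`F = ∅`, BHK's conditional positive association itself.
Proof: the alternating theorem `WForm.Q_nonneg_of_alternating` with `α = Set V`; the dictionary
`∑_C cw C t φ C = E[φ(C(s)) · 1{C(s) ∩ (T ∪ (F ∩ t)) = ∅}]`; (H1) from `bhk_induced` applied to the
monotone functionals `φ − min φ`; the hub is any `F`-free cluster of positive weight, and if there
is none the form vanishes identically (meet of two witnessing configurations).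
-/

namespace Summit.Ventures.PercRepro2

section WExt

open scoped Classical

variable {V : Type*} {E : Type*} [Fintype E] [DecidableEq E] [Fintype V] [DecidableEq V]
  {R : Type*} [Field R] [LinearOrder R] [IsStrictOrderedRing R]
variable (p : E → R) (ends : E → Sym2 V) (s : V) (T F : Finset V)

/-- The avoiding cluster law `P(C(s) = C, C(s) ∩ T = ∅)` as a weight on `Set V`. -/
noncomputable def clusterW (C : Set V) : R :=
  prob p (clusterEvent ends s C ∩ avoidAll ends s T)

omit [Fintype E] [DecidableEq E] [Fintype V] [DecidableEq V] in
/-- `F`-disjointness of two vertex sets. -/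
def FDisjoint (C C' : Set V) : Prop := Disjoint (C ∩ ↑F) (C' ∩ ↑F)

/-- **(W-ext)** for `(G, s, T, F)`: the W-inequality of the avoiding cluster law with
`F`-disjointness, for all monotone functionals of the whole cluster. -/
def WExt : Prop := WForm.WIneq (FDisjoint F) (clusterW p ends s T)

omit [Fintype E] [DecidableEq E] [Fintype V] [DecidableEq V] in
/-- `FDisjoint` is symmetric. -/
lemma FDisjoint.symm {C C' : Set V} (h : FDisjoint F C C') : FDisjoint F C' C :=
  Disjoint.symm h

omit [Fintype E] [DecidableEq E] [Fintype V] [DecidableEq V] in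
/-- `FDisjoint` is antitone in its first argument. -/
lemma FDisjoint.mono_left {C C' t : Set V} (hle : C ≤ C') (h : FDisjoint F C' t) :
    FDisjoint F C t :=
  Disjoint.mono_left (Set.inter_subset_inter_left _ hle) h

omit [Fintype E] [DecidableEq E] [Fintype V] in
/-- The avoidance of `T ∪ (F ∩ t)` is «`F`-disjoint from `t` and avoid `T`». -/
lemma mem_avoidAll_union_filter_iff (ω : Config E) (t : Set V) :
    ω ∈ avoidAll ends s (T ∪ F.filter (fun v => v ∈ t)) ↔
      FDisjoint F (cluster ends ω s) t ∧ ω ∈ avoidAll ends s T := by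
  constructor
  · intro hA
    refine ⟨?_, fun x hx => hA x (Finset.mem_union_left _ hx)⟩
    rw [FDisjoint, Set.disjoint_left]
    rintro x ⟨hxC, hxF⟩ ⟨hxt, _⟩
    exact hA x (Finset.mem_union_right _ (Finset.mem_filter.mpr ⟨hxF, hxt⟩)) hxC
  · rintro ⟨h1, h2⟩ x hx
    rcases Finset.mem_union.mp hx with hx | hx
    · exact h2 x hx
    · intro hc
      rw [Finset.mem_filter] at hx
      rw [FDisjoint, Set.disjoint_left] at h1
      exact h1 ⟨hc, hx.1⟩ ⟨hx.2, hx.1⟩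

omit [LinearOrder R] [IsStrictOrderedRing R] in
/-- **Dictionary**: `∑_C cw C t φ C = E[φ(C(s)) · 1{C(s) ∩ (T ∪ (F ∩ t)) = ∅}]`. -/
lemma sum_cw_clusterW_eq (φ : Set V → R) (t : Set V) :
    ∑ C, WForm.cw (FDisjoint F) (clusterW p ends s T) C t * φ C =
      expect p (fun ω => φ (cluster ends ω s) *
        (avoidAll ends s (T ∪ F.filter (fun v => v ∈ t))).indicator 1 ω) := by
  have e1 : ∀ C, WForm.cw (FDisjoint F) (clusterW p ends s T) C t * φ C =
      ∑ ω, weight p ω * ((if FDisjoint F C t then (1 : R) else 0) *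
        (clusterEvent ends s C ∩ avoidAll ends s T).indicator 1 ω * φ C) := by
    intro C
    unfold WForm.cw clusterW
    by_cases hD : FDisjoint F C t
    · rw [if_pos hD, if_pos hD, prob_eq_expect_indicator]
      unfold expect
      rw [Finset.sum_mul]
      refine Finset.sum_congr rfl fun ω _ => ?_
      ring
    · rw [if_neg hD, if_neg hD]
      simp
  simp_rw [e1]
  rw [Finset.sum_comm]
  unfold expect
  refine Finset.sum_congr rfl fun ω _ => ?_
  dsimp only
  rw [← Finset.mul_sum]
  congr 1
  rw [Finset.sum_eq_single (cluster ends ω s)]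
  · by_cases hA : ω ∈ avoidAll ends s (T ∪ F.filter (fun v => v ∈ t))
    · have hA' := (mem_avoidAll_union_filter_iff ends s T F ω t).mp hA
      rw [Set.indicator_of_mem hA, if_pos hA'.1,
        Set.indicator_of_mem (show ω ∈ clusterEvent ends s (cluster ends ω s) ∩ avoidAll ends s T
          from ⟨rfl, hA'.2⟩)]
      simp
    · rw [Set.indicator_of_notMem hA]
      by_cases hD : FDisjoint F (cluster ends ω s) t
      · have hT : ω ∉ avoidAll ends s T := fun hT =>
          hA ((mem_avoidAll_union_filter_iff ends s T F ω t).mpr ⟨hD, hT⟩)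
        have hE : ω ∉ clusterEvent ends s (cluster ends ω s) ∩ avoidAll ends s T :=
          fun hE => hT hE.2
        rw [Set.indicator_of_notMem hE]
        simp
      · rw [if_neg hD]
        simp
  · intro C _ hne
    have hE : ω ∉ clusterEvent ends s C ∩ avoidAll ends s T := fun hE => hne hE.1.symm
    rw [Set.indicator_of_notMem hE]
    simp
  · intro h; exact absurd (Finset.mem_univ _) h

omit [LinearOrder R] [IsStrictOrderedRing R] in
/-- The normaliser is the avoidance probability. -/
lemma Z_clusterW_eq (t : Set V) :
    WForm.Z (FDisjoint F) (clusterW p ends s T) t =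
      prob p (avoidAll ends s (T ∪ F.filter (fun v => v ∈ t))) := by
  unfold WForm.Z
  have := sum_cw_clusterW_eq p ends s T F (fun _ => (1 : R)) t
  simp only [mul_one, one_mul] at this
  rw [this, prob_eq_expect_indicator]

omit [Fintype E] [DecidableEq E] [Fintype V] [DecidableEq V] in
/-- Shifting a monotone functional by its minimum keeps it monotone. -/
lemma monotone_sub_const {φ : Set V → R} (hφ : Monotone φ) (c : R) :
    Monotone (fun C => φ C - c) := fun _ _ h => sub_le_sub_right (hφ h) c

omit [Fintype E] [DecidableEq E] [DecidableEq V] in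
/-- Shifting by the minimum makes the functional nonnegative. -/
lemma sub_lo_nonneg (φ : Set V → R) (C : Set V) : 0 ≤ φ C - WForm.lo (∅ : Set V) φ :=
  sub_nonneg.mpr (WForm.lo_le (∅ : Set V) φ C)

/-- **(H1) for the avoiding cluster law** — van den Berg–Häggström–Kahn (`bhk_induced` with
`X = Y = T ∪ (F ∩ t)`): every conditional weight is positively associated for monotone pairs. -/
theorem condPA_clusterW (hp : IsProbVec p) :
    WForm.CondPA (FDisjoint F) (clusterW p ends s T) := by
  intro t g h hg hh
  set X : Finset V := T ∪ F.filter (fun v => v ∈ t) with hX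
  set A : Set (Config E) := avoidAll ends s X with hA
  set m₁ : R := WForm.lo (∅ : Set V) g with hm₁
  set m₂ : R := WForm.lo (∅ : Set V) h with hm₂
  have hbhk := bhk_induced p hp ends s (monotone_sub_const hg m₁) (monotone_sub_const hh m₂)
    (sub_lo_nonneg g) (sub_lo_nonneg h) Finset.univ X X (Finset.subset_univ _)
    (Finset.subset_univ _)
  simp only [Finset.inter_self, Finset.union_self, REvent_univ] at hbhk
  have e : ∀ (G : Set V → R), clusterObs ends Finset.univ s G * A.indicator 1 =
      fun ω => G (cluster ends ω s) * A.indicator 1 ω := by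
    intro G
    funext ω
    simp only [Pi.mul_apply, clusterObs_apply, clusterIn_univ]
  rw [e, e, e] at hbhk
  simp only [Pi.mul_apply] at hbhk
  rw [expect_sub_const_mul_indicator, expect_sub_const_mul_indicator,
    expect_sub_mul_sub_mul_indicator] at hbhk
  have d1 := sum_cw_clusterW_eq p ends s T F g t
  have d2 := sum_cw_clusterW_eq p ends s T F h t
  have d3 := sum_cw_clusterW_eq p ends s T F (fun C => g C * h C) t
  have dZ := Z_clusterW_eq p ends s T F t
  rw [d1, d2, d3, dZ]
  rw [← hX, ← hA] at *
  nlinarith [hbhk]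

omit [Fintype V] [DecidableEq V] in
/-- **The degenerate case**: if no `F`-free cluster has positive weight, no two `F`-disjoint
clusters both have positive weight (the meet of two witnessing configurations has positive
weight, an `F`-free cluster and avoids `T`). -/
lemma clusterW_mul_eq_zero_of_FDisjoint (hp : IsProbVec p)
    (hno : ∀ C : Set V, C ∩ ↑F = ∅ → clusterW p ends s T C = 0) {C C' : Set V}
    (hCC' : FDisjoint F C C') : clusterW p ends s T C * clusterW p ends s T C' = 0 := by
  by_contra hne
  have hC : clusterW p ends s T C ≠ 0 := left_ne_zero_of_mul hne
  have hC' : clusterW p ends s T C' ≠ 0 := right_ne_zero_of_mul hne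
  unfold clusterW at hC hC'
  obtain ⟨ω, hω, hw⟩ := exists_pos_weight_of_prob_ne_zero p hp hC
  obtain ⟨ω', hω', hw'⟩ := exists_pos_weight_of_prob_ne_zero p hp hC'
  have hmeet := weight_meet_pos p hp hw hw'
  set ω'' : Config E := fun e => ω e && ω' e with hω''
  have hsub : cluster ends ω'' s ⊆ C ∩ C' := by
    rw [← hω.1, ← hω'.1]
    exact Set.subset_inter (cluster_mono (meet_le_left ω ω') s) (cluster_mono (meet_le_right ω ω') s)
  have hfree : cluster ends ω'' s ∩ ↑F = ∅ := by
    rw [FDisjoint, Set.disjoint_left] at hCC'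
    ext x
    simp only [Set.mem_inter_iff, Set.mem_empty_iff_false, iff_false, not_and]
    intro hx hxF
    have hx' := hsub hx
    exact hCC' ⟨hx'.1, hxF⟩ ⟨hx'.2, hxF⟩
  have hmem : ω'' ∈ clusterEvent ends s (cluster ends ω'' s) ∩ avoidAll ends s T :=
    ⟨rfl, fun x hx hc => hω.2 x hx (conn_mono (meet_le_left ω ω') hc)⟩
  exact (prob_pos_of_mem p hp hmem hmeet).ne' (hno _ hfree)

omit [DecidableEq V] in
/-- In the degenerate case the W-form vanishes identically. -/
lemma Q_clusterW_eq_zero (hp : IsProbVec p)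
    (hno : ∀ C : Set V, C ∩ ↑F = ∅ → clusterW p ends s T C = 0) (g h : Set V → R) :
    WForm.Q (FDisjoint F) (clusterW p ends s T) g h = 0 := by
  unfold WForm.Q WForm.S
  refine Finset.sum_eq_zero fun C _ => Finset.sum_eq_zero fun C' _ => ?_
  unfold WForm.coef
  split_ifs with hD
  · rw [clusterW_mul_eq_zero_of_FDisjoint p ends s T F hp hno hD, zero_mul]
  · exact zero_mul _

/-- **(W-ext) holds**: for every admissible weight vector, root, avoided set `T` and disjointness
set `F`, the avoiding cluster law satisfies the W-inequality with `F`-disjointness for all monotone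
functionals of the whole cluster. -/
theorem wExt_all [Archimedean R] (hp : IsProbVec p) : WExt p ends s T F := by
  have hW : ∀ C, 0 ≤ clusterW p ends s T C := fun C => prob_nonneg hp _
  have hD : ∀ C C', FDisjoint F C C' → FDisjoint F C' C := fun _ _ hd => hd.symm
  have hD1 : ∀ C C' t : Set V, C ≤ C' → FDisjoint F C' t → FDisjoint F C t :=
    fun _ _ _ hle hd => FDisjoint.mono_left F hle hd
  have hH1 := condPA_clusterW p ends s T F hp
  refine ⟨hW, ?_⟩
  intro g h hg hh
  by_cases hhub : ∃ C₀ : Set V, C₀ ∩ ↑F = ∅ ∧ 0 < clusterW p ends s T C₀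
  · obtain ⟨C₀, hC₀, hpos⟩ := hhub
    have hD0 : ∀ t, FDisjoint F C₀ t := by
      intro t
      unfold FDisjoint
      rw [hC₀]
      exact Set.disjoint_left.mpr fun x hx => absurd hx (Set.notMem_empty x)
    exact WForm.Q_nonneg_of_alternating hW hD hD1 C₀ hD0 hpos hH1 hg hh
  · have hno : ∀ C : Set V, C ∩ ↑F = ∅ → clusterW p ends s T C = 0 := by
      intro C hC
      by_contra hne
      exact hhub ⟨C, hC, lt_of_le_of_ne (hW C) (Ne.symm hne)⟩
    rw [Q_clusterW_eq_zero p ends s T F hp hno g h]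

end WExt

end Summit.Ventures.PercRepro2
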